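import Summits.QuantumFields.BalabanUV.Beta.GAN24.ThirdJetKernel
import Summits.QuantumFields.BalabanUV.Beta.GAN24.E3UnitSplitLevels

/-!
# `BalabanUV.Beta.GAN24.ThirdJetThreeKernel` — binder row G-an2-4 / (CONV-C), S-slot («E3Shape» ∧ «E3SupRate»), road S3, DIFF row **R3-dV**
# (typer `LEAVES.md` v3.3 PART III § III.R, holder `b2b-balaban-gan24-formalise-leaf-03-g15`, INTENT «ROW-dV*» journal l.5224), part 2
# (generic `d`): THE THIRD-JET FUNCTIONAL WITH THREE INDEPENDENT KERNEL LEGS `e3K3 X Y Z` — telescoping in the kernels, the two-channel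
# unit split for off-diagonal tables with ABSTRACT legs, and the units covariance (the trilinear extension of leaf-05-g19's `ThirdJetKernel.e3K`)

NOT IN PRINT; OUR BOOKKEEPING.  HONEST FRAMING (cell contract, verbatim): «discharging `BetaPertH` makes Bałaban's UV stability
UNCONDITIONAL — a real constructive-QFT result; it is NOT the continuum limit and NOT the Clay problem.»  HONEST DEPENDENCY (verbatim):
«continuum YM on T⁴ ⇐ BetaPertH ∧ nine spine estimates (0/9 proved); BetaPertH ⇐ (D1) ∧ (D4) ∧ CAP+tail; G-an2-4 gates asym, D1 and
NE2/3/4.»  [folklore] kernel calculus over the tree's sockets BY NAME — `ExpKernelCalculus.comp`, an2's `OneStepKernelFamily.vertexOfK`/`colH`,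
`BalabanStepJetsSucc.mmRead`, the linearity bricks of `KernelWard` / `HessKerRate`, asym1's leg units `HessKerDressedUnits`, leaf-01's scalar pulls
`E3UnitSplit.pull_two_inner` / `pull_two_legs` and exponent identity `e3VH_residual`; generic `d`, generic blocking `L`, kernels ABSTRACT; ONE
plumbing `def` (`e3K3`); NO estimate, NO cited fact, NO `def … : Prop`, NO wall binder; the reserved family `GAN24.StencilSlotE3*` is untouched.
Discharges NOTHING of «E3Shape»/«E3SupRate»/(hS, hSall); NOT BetaPertH, NOT continuum, NOT Clay.

## Why (the located use: row dV; part 1 = `GAN24/DilatedBorderThirdJet`)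
By part 1, member `n+3`'s depth-`(n−m)` pushed border piece is member `n+2`'s depth-`(n−m)` TABLE read through the `Lc`-decimated level-`(n+3)`
resolvent, while member `n+2`'s piece is the same table through `KInv (Lc^{n+2})`: the DIFF row compares ONE trilinear functional of the table at
two kernels.  The difference telescopes into three terms, each with ONE leg replaced by a difference of kernels — which is why the functional is
developed here with the three kernel legs INDEPENDENT.

## What is proved (generic `d`, any `L`)
§1 `e3K3 X Y Z L S κ′ u′ := −mmRead L (X ∘ vertexOfK Y L S κ′ u′ ∘ Z)`; `e3K3 K K K = e3K K` (`e3K3_self`, `rfl`); `e3OfS = e3K3 (KInv N)³`; pins;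
   scalar linearity in the table; the raw `(inl, inl)` entry (`rfl`) and the TWO-CHANNEL form for an off-diagonal table (`e3K3_offdiag`).
§2 `vertexOfK_sub_kernel` (the chain-rule vertex is linear in the kernel, given absolute convergence) and **`e3K3_sub_telescope`**:
   `e3K3 X′Y′Z′ − e3K3 XYZ = e3K3 (X′−X) Y′ Z′ + e3K3 X (Y′−Y) Z′ + e3K3 X Y (Z′−Z)` (entrywise; decaying kernels, local table).
§3 **`e3K3_VH_unit_split_of`** — leaf-01's (V-H) template `E3UnitSplit.e3VH_unit_split_of` with the three legs ABSTRACT: for an off-diagonal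
   family `P` with the level-`ℓ` border weight pushed `k` times (member `p = ℓ+k+1`, `N = Lc^p`),
   `N^{2(d+1)}·e3K3 X Y Z N ((Lc^{d+1})^k·cVH·M^{d+2} • P) = −(cVH/Lc^{d+1})·N^{−2}·M·[two-channel unit sandwich of P with legs
   N^{2(d+1)}·X_{mm}, N^{d+2}·X_{mf} (rows), N^{d+2}·colH Y (vertex, block average N^{−(d+1)}Σ'_u), N^{d+2}·Z_{fm}, N^{2(d+1)}·Z_{mm} (columns)]`.
§4 UNITS: `unitS_smul_sq_offdiag` (`unitS s_f s_m ((s_f s_m)² • P) = P` for off-diagonal `P`) and **`e3K3_unitK_offdiag`**: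
   `e3K3 (DXD) (DYD) (DZD) L P = (s_m² (s_f s_m)²) • e3K3 X Y Z L P` (`D = diag(s_f ∣ s_m)`, nonzero units, `P` off-diagonal).
-/

noncomputable section

open Finset
open scoped BigOperators
open Literature.MathematicalPhysics.QuantumFieldTheory
open Literature.MathematicalPhysics.QuantumFieldTheory.Balaban1983to89
open Literature.MathematicalPhysics.QuantumFieldTheory.Balaban1983to89.Beta
open B12Sec2to5 (l1 l1_nonneg)
open ExpKernelCalculus (MKer Decays BiLoc VertexFamily comp Zl Zl_nonneg)
open OneStepResolventKernel (Fib LocStencil KInv wsum decays_mono biLoc_mono summable_wsumTerm)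
open OneStepKernelFamily (vertexOfK colH vertexOfK_KInv vertexFamily_vertexOfK abs_colH_le)
open BalabanStepJetsSucc (mmRead mmRead_inl_inl mmRead_inr_left mmRead_inr_right)
open KernelWard (Bdd bdd_of_decays bdd_of_biLoc comp_sub_left comp_sub_right slices_biLoc_bdd slices_bdd_biLoc)
open HessKerRate (scaleK comp_scaleK colH_sub)
open DecLiftAdjoint (vertexOfK_smul)
open Summit.QuantumFields.BalabanUV.Beta.HessKerDressedUnits (legScale unitK unitS counitK vertexOfK_unit legScale_mul_legScale_inv
  legScale_inv_mul_legScale legScale_inl legScale_inr unitS_apply)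
open Summit.QuantumFields.BalabanUV.Beta.GAN24.E3UnitSplit (e3OfS pull_two_inner pull_two_legs e3VH_residual)
open Summit.QuantumFields.BalabanUV.Beta.GAN24.ThirdJetKernel (e3K e3OfS_eq_e3K mmRead_smul mmRead_sub)

namespace Summit.QuantumFields.BalabanUV.Beta.GAN24.ThirdJetThreeKernel

variable {d : ℕ}

/-! ## §1 The functional with three independent kernel legs -/

/-- [folklore] **THE THIRD-JET FUNCTIONAL WITH THREE KERNEL LEGS** (row leg `X`, vertex leg `Y` — its `ℋ`-column enters the chain-rule
vertex —, column leg `Z`) at blocking `L`: `e3K3 X Y Z L S κ′ u′ := −mmRead L (X ∘ vertexOfK Y L S κ′ u′ ∘ Z)`.  leaf-05-g19's `e3K K` is the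
diagonal `X = Y = Z = K` (`e3K3_self`).  A definition asserting nothing. -/
def e3K3 (X Y Z : MKer (d + 1) (Fib d)) (L : ℕ) (S : Fin (d + 1) → (Fin (d + 1) → ℤ) → MKer (d + 1) (Fib d)) (κ' : Fin (d + 1))
    (u' : Fin (d + 1) → ℤ) : MKer (d + 1) (Fib d) :=
  fun x z a b => -(mmRead L (comp (comp X (vertexOfK Y L S κ' u')) Z) x z a b)

/-- [folklore] The diagonal of `e3K3` is `e3K`. -/
theorem e3K3_self (K : MKer (d + 1) (Fib d)) (L : ℕ) (S : Fin (d + 1) → (Fin (d + 1) → ℤ) → MKer (d + 1) (Fib d))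
    (κ' : Fin (d + 1)) (u' : Fin (d + 1) → ℤ) : e3K3 K K K L S κ' u' = e3K K L S κ' u' := rfl

/-- [folklore] leaf-01's `e3OfS N S` is `e3K3` on the diagonal `KInv N`. -/
theorem e3OfS_eq_e3K3 {N : ℕ} [NeZero N] (S : Fin (d + 1) → (Fin (d + 1) → ℤ) → MKer (d + 1) (Fib d)) (κ' : Fin (d + 1))
    (u' : Fin (d + 1) → ℤ) :
    e3OfS N S κ' u' = e3K3 (KInv (N := N) (d := d)) (KInv (N := N) (d := d)) (KInv (N := N) (d := d)) N S κ' u' := by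
  rw [e3OfS_eq_e3K]; rfl

/-- [folklore] `e3K3` has no multiplier legs (left). -/
@[simp] theorem e3K3_inr_left (X Y Z : MKer (d + 1) (Fib d)) (L : ℕ) (S : Fin (d + 1) → (Fin (d + 1) → ℤ) → MKer (d + 1) (Fib d))
    (κ' : Fin (d + 1)) (u' x z : Fin (d + 1) → ℤ) (μ : Fin (d + 1)) (b : Fib d) : e3K3 X Y Z L S κ' u' x z (Sum.inr μ) b = 0 := by
  simp only [e3K3, mmRead_inr_left, neg_zero]

/-- [folklore] `e3K3` has no multiplier legs (right). -/
@[simp] theorem e3K3_inr_right (X Y Z : MKer (d + 1) (Fib d)) (L : ℕ) (S : Fin (d + 1) → (Fin (d + 1) → ℤ) → MKer (d + 1) (Fib d))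
    (κ' : Fin (d + 1)) (u' x z : Fin (d + 1) → ℤ) (a : Fib d) (ν : Fin (d + 1)) : e3K3 X Y Z L S κ' u' x z a (Sum.inr ν) = 0 := by
  simp only [e3K3, mmRead_inr_right, neg_zero]

/-- [folklore] `e3K3` is linear in the table: scalars (unconditional, `tsum_mul_left` only). -/
theorem e3K3_smul (X Y Z : MKer (d + 1) (Fib d)) (L : ℕ) (c : ℝ) (S : Fin (d + 1) → (Fin (d + 1) → ℤ) → MKer (d + 1) (Fib d))
    (κ' : Fin (d + 1)) (u' : Fin (d + 1) → ℤ) :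
    e3K3 X Y Z L (fun κ u => c • S κ u) κ' u' = c • e3K3 X Y Z L S κ' u' := by
  funext x z a b
  simp only [e3K3, vertexOfK_smul, KernelReflection.comp_smul_right, KernelReflection.comp_smul_left, mmRead_smul, Pi.smul_apply,
    smul_eq_mul, mul_neg]

/-- [folklore] The raw `(inl, inl)` entry of `e3K3` (definitions unfolded; tsum nesting as defined). -/
theorem e3K3_inl_inl (X Y Z : MKer (d + 1) (Fib d)) (L : ℕ) (S : Fin (d + 1) → (Fin (d + 1) → ℤ) → MKer (d + 1) (Fib d))
    (κ' : Fin (d + 1)) (u' x' z' : Fin (d + 1) → ℤ) (α β : Fin (d + 1)) :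
    e3K3 X Y Z L S κ' u' x' z' (Sum.inl α) (Sum.inl β) =
      -∑' y : Fin (d + 1) → ℤ, ∑ g : Fib d,
        (∑' w : Fin (d + 1) → ℤ, ∑ f : Fib d, X ((L : ℤ) • x') w (Sum.inr α) f *
            ∑ κ'' : Fin (d + 1), ∑' u : Fin (d + 1) → ℤ, Y u ((L : ℤ) • u') (Sum.inl κ'') (Sum.inr κ') * S κ'' u w y f g) *
          Z y ((L : ℤ) • z') g (Sum.inr β) := by
  rfl

/-- [folklore] **THE TWO-CHANNEL FORM FOR AN OFF-DIAGONAL TABLE** (no ff, no mm block): inside the outer tsum, the `mf` channel (row leg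
`X_{mm}`, column leg `Z_{fm}`) plus the `fm` channel (row leg `X_{mf}`, column leg `Z_{mm}`); the vertex leg is the `ℋ`-column of `Y`. -/
theorem e3K3_offdiag (X Y Z : MKer (d + 1) (Fib d)) (L : ℕ) (S : Fin (d + 1) → (Fin (d + 1) → ℤ) → MKer (d + 1) (Fib d))
    (hff : ∀ κ u x z α β, S κ u x z (Sum.inl α) (Sum.inl β) = 0) (hmm : ∀ κ u x z μ ν, S κ u x z (Sum.inr μ) (Sum.inr ν) = 0)
    (κ' : Fin (d + 1)) (u' x' z' : Fin (d + 1) → ℤ) (α β : Fin (d + 1)) :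
    e3K3 X Y Z L S κ' u' x' z' (Sum.inl α) (Sum.inl β) =
      -∑' y : Fin (d + 1) → ℤ,
        ((∑ l' : Fin (d + 1),
          (∑' w : Fin (d + 1) → ℤ, ∑ l : Fin (d + 1), X ((L : ℤ) • x') w (Sum.inr α) (Sum.inr l) *
              ∑ κ'' : Fin (d + 1), ∑' u : Fin (d + 1) → ℤ,
                Y u ((L : ℤ) • u') (Sum.inl κ'') (Sum.inr κ') * S κ'' u w y (Sum.inr l) (Sum.inl l')) *
            Z y ((L : ℤ) • z') (Sum.inl l') (Sum.inr β)) +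
        ∑ l' : Fin (d + 1),
          (∑' w : Fin (d + 1) → ℤ, ∑ l : Fin (d + 1), X ((L : ℤ) • x') w (Sum.inr α) (Sum.inl l) *
              ∑ κ'' : Fin (d + 1), ∑' u : Fin (d + 1) → ℤ,
                Y u ((L : ℤ) • u') (Sum.inl κ'') (Sum.inr κ') * S κ'' u w y (Sum.inl l) (Sum.inr l')) *
            Z y ((L : ℤ) • z') (Sum.inr l') (Sum.inr β)) := by
  rw [e3K3_inl_inl]
  simp only [Fintype.sum_sum_type, hff, hmm, mul_zero, tsum_zero, Finset.sum_const_zero, zero_add, add_zero]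

/-! ## §2 Telescoping in the three kernels -/

/-- [folklore] **THE CHAIN-RULE VERTEX IS LINEAR IN THE KERNEL** (decaying kernels at a common rate, local table; all series absolutely
convergent): `vertexOfK Y′ L S μ y − vertexOfK Y L S μ y = vertexOfK (Y′ − Y) L S μ y`. -/
theorem vertexOfK_sub_kernel {Y Y' : MKer (d + 1) (Fib d)} {C C' δK : ℝ} (hY : Decays Y C δK) (hY' : Decays Y' C' δK)
    {S : Fin (d + 1) → (Fin (d + 1) → ℤ) → MKer (d + 1) (Fib d)} {Cs δ : ℝ} (hS : LocStencil S Cs δ) (hδ : 0 < δ) (hδK : δ ≤ δK)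
    (L : ℕ) (μ : Fin (d + 1)) (y : Fin (d + 1) → ℤ) :
    vertexOfK Y' L S μ y - vertexOfK Y L S μ y = vertexOfK (Y' - Y) L S μ y := by
  have hC : 0 ≤ C := hY.nonneg (Sum.inl 0)
  have hC' : 0 ≤ C' := hY'.nonneg (Sum.inl 0)
  have hYδ : Decays Y C δ := decays_mono hY hC le_rfl hδK
  have hYδ' : Decays Y' C' δ := decays_mono hY' hC' le_rfl hδK
  funext x z a b
  simp only [Pi.sub_apply, vertexOfK]
  rw [← Finset.sum_sub_distrib]
  refine Finset.sum_congr rfl fun κ' _ => ?_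
  have hw : ∀ u, |colH Y L μ y κ' u| ≤ C * Real.exp (-δ * l1 (u - (L : ℤ) • y)) := fun u => abs_colH_le hYδ μ y κ' u
  have hw' : ∀ u, |colH Y' L μ y κ' u| ≤ C' * Real.exp (-δ * l1 (u - (L : ℤ) • y)) := fun u => abs_colH_le hYδ' μ y κ' u
  have hs := summable_wsumTerm hw (fun u => hS κ' u) hδ hC x z a b
  have hs' := summable_wsumTerm hw' (fun u => hS κ' u) hδ hC' x z a b
  simp only [wsum]
  rw [← hs'.tsum_sub hs]
  refine tsum_congr fun u => ?_
  rw [colH_sub]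
  ring

/-- [folklore] `Pi` subtraction of kernels, applied. -/
theorem mker_sub_apply' (A B : MKer (d + 1) (Fib d)) (x z : Fin (d + 1) → ℤ) (a b : Fib d) :
    (A - B) x z a b = A x z a b - B x z a b := rfl

/-- [folklore] **TELESCOPING OF `e3K3` IN ITS THREE KERNELS** (entrywise; kernels decaying at a common rate `δK`, table local at rate
`0 < δ ≤ δK`; all series absolutely convergent by the tree's slice lemmas):
`e3K3 X′Y′Z′ − e3K3 XYZ = e3K3 (X′−X) Y′ Z′ + e3K3 X (Y′−Y) Z′ + e3K3 X Y (Z′−Z)`. -/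
theorem e3K3_sub_telescope {X X' Y Y' Z Z' : MKer (d + 1) (Fib d)} {CX CX' CY CY' CZ CZ' δK : ℝ}
    (hX : Decays X CX δK) (hX' : Decays X' CX' δK) (hY : Decays Y CY δK) (hY' : Decays Y' CY' δK)
    (hZ : Decays Z CZ δK) (hZ' : Decays Z' CZ' δK)
    {S : Fin (d + 1) → (Fin (d + 1) → ℤ) → MKer (d + 1) (Fib d)} {Cs δ : ℝ} (hS : LocStencil S Cs δ) (hδ : 0 < δ) (hδK : δ ≤ δK)
    (L : ℕ) (κ' : Fin (d + 1)) (u' x z : Fin (d + 1) → ℤ) (a b : Fib d) :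
    e3K3 X' Y' Z' L S κ' u' x z a b - e3K3 X Y Z L S κ' u' x z a b =
      e3K3 (X' - X) Y' Z' L S κ' u' x z a b + e3K3 X (Y' - Y) Z' L S κ' u' x z a b + e3K3 X Y (Z' - Z) L S κ' u' x z a b := by
  have hCX : 0 ≤ CX := hX.nonneg (Sum.inl 0)
  have hCX' : 0 ≤ CX' := hX'.nonneg (Sum.inl 0)
  have hCY : 0 ≤ CY := hY.nonneg (Sum.inl 0)
  have hCY' : 0 ≤ CY' := hY'.nonneg (Sum.inl 0)
  have hδ0 : 0 ≤ δK := hδ.le.trans hδK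
  -- the three vertices
  have hYY : Decays (Y' - Y) (CY' + CY) δK := HessKerRate.decays_sub hY' hY
  have bV := vertexFamily_vertexOfK (N := L) hY hCY hS hδ hδK κ' u'
  have bV' := vertexFamily_vertexOfK (N := L) hY' hCY' hS hδ hδK κ' u'
  have bVd := vertexFamily_vertexOfK (N := L) hYY (by positivity) hS hδ hδK κ' u'
  have hδ2 : (0 : ℝ) < δ / 2 := by positivity
  have hδ4 : (0 : ℝ) < δ / 4 := by positivity
  -- bounded outer kernels
  have bX : Bdd X CX := bdd_of_decays hX hδ0
  have bX' : Bdd X' CX' := bdd_of_decays hX' hδ0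
  have bZ : Bdd Z CZ := bdd_of_decays hZ hδ0
  have bZ' : Bdd Z' CZ' := bdd_of_decays hZ' hδ0
  have bXX : Bdd (X' - X) (CX' + CX) := bdd_of_decays (HessKerRate.decays_sub hX' hX) hδ0
  have bZZ : Bdd (Z' - Z) (CZ' + CZ) := bdd_of_decays (HessKerRate.decays_sub hZ' hZ) hδ0
  -- the inner compositions are bi-localised (rate δ/4)
  have hX2 : Decays X CX (δ / 2) := decays_mono hX hCX le_rfl (by linarith)
  have hX2' : Decays X' CX' (δ / 2) := decays_mono hX' hCX' le_rfl (by linarith)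
  have hXX2 : Decays (X' - X) (CX' + CX) (δ / 2) := decays_mono (HessKerRate.decays_sub hX' hX) (by positivity) le_rfl (by linarith)
  have cXV := ExpKernelCalculus.biLoc_comp_decays hX2 bV hδ4.le (by linarith)
  have cXV' := ExpKernelCalculus.biLoc_comp_decays hX2 bV' hδ4.le (by linarith)
  have cX'V' := ExpKernelCalculus.biLoc_comp_decays hX2' bV' hδ4.le (by linarith)
  have cXXV' := ExpKernelCalculus.biLoc_comp_decays hXX2 bV' hδ4.le (by linarith)
  have cXVd := ExpKernelCalculus.biLoc_comp_decays hX2 bVd hδ4.le (by linarith)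
  -- (1) `X′V′Z′ − XV′Z′ = ((X′−X)V′) Z′`
  have e1 : comp (comp X' (vertexOfK Y' L S κ' u')) Z' - comp (comp X (vertexOfK Y' L S κ' u')) Z' =
      comp (comp (X' - X) (vertexOfK Y' L S κ' u')) Z' := by
    rw [← comp_sub_left (slices_biLoc_bdd cX'V' bZ' hδ4) (slices_biLoc_bdd cXV' bZ' hδ4),
      ← comp_sub_left (slices_bdd_biLoc bX' bV' hδ2) (slices_bdd_biLoc bX bV' hδ2)]
  -- (2) `XV′Z′ − XVZ′ = (X(V′−V)) Z′`, `V′ − V = vertexOfK (Y′−Y)`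
  have e2 : comp (comp X (vertexOfK Y' L S κ' u')) Z' - comp (comp X (vertexOfK Y L S κ' u')) Z' =
      comp (comp X (vertexOfK (Y' - Y) L S κ' u')) Z' := by
    rw [← comp_sub_left (slices_biLoc_bdd cXV' bZ' hδ4) (slices_biLoc_bdd cXV bZ' hδ4),
      ← comp_sub_right (slices_bdd_biLoc bX bV' hδ2) (slices_bdd_biLoc bX bV hδ2),
      vertexOfK_sub_kernel hY hY' hS hδ hδK L κ' u']
  -- (3) `XVZ′ − XVZ = (XV)(Z′−Z)`
  have e3 : comp (comp X (vertexOfK Y L S κ' u')) Z' - comp (comp X (vertexOfK Y L S κ' u')) Z =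
      comp (comp X (vertexOfK Y L S κ' u')) (Z' - Z) := by
    rw [← comp_sub_right (slices_biLoc_bdd cXV bZ' hδ4) (slices_biLoc_bdd cXV bZ hδ4)]
  -- assemble entrywise
  rcases a with α | μ
  · rcases b with β | ν
    · have h1 := congrFun (congrFun (congrFun (congrFun e1 ((L : ℤ) • x)) ((L : ℤ) • z)) (Sum.inr α)) (Sum.inr β)
      have h2 := congrFun (congrFun (congrFun (congrFun e2 ((L : ℤ) • x)) ((L : ℤ) • z)) (Sum.inr α)) (Sum.inr β)
      have h3 := congrFun (congrFun (congrFun (congrFun e3 ((L : ℤ) • x)) ((L : ℤ) • z)) (Sum.inr α)) (Sum.inr β)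
      simp only [mker_sub_apply'] at h1 h2 h3
      simp only [e3K3, mmRead_inl_inl]
      linarith
    · simp only [e3K3_inr_right, sub_zero, add_zero]
  · simp only [e3K3_inr_left, sub_zero, add_zero]

/-! ## §3 The (V-H) unit split with three abstract legs -/

section Split

variable {Lc : ℕ} [NeZero Lc]

/-- [folklore] **`e3K3_VH_unit_split_of` — leaf-01's (V-H) TEMPLATE WITH THE THREE LEGS ABSTRACT.**  For ANY off-diagonal family `P` with the
level-`ℓ` border weight pushed `k` times (member `p = ℓ+k+1`, `N = Lc^p`) and any kernels `X, Y, Z`: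
`N^{2(d+1)}·e3K3 X Y Z N ((Lc^{d+1})^k·cVH·M^{d+2} • P) = −(cVH/Lc^{d+1})·N^{−2}·M·[two-channel unit sandwich of P]` with row legs `N^{2(d+1)}·X_{mm}`,
`N^{d+2}·X_{mf}`, vertex leg `N^{d+2}·(ℋ-column of Y)` under the block average `N^{−(d+1)}Σ'_u`, column legs `N^{d+2}·Z_{fm}`, `N^{2(d+1)}·Z_{mm}` — the
residual `N^{−2}·M` DISPLAYED (`E3UnitSplit.e3VH_residual`).  At `X = Y = Z = KInv N` this is `E3UnitSplit.e3VH_unit_split_of` (with the tree's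
pins `KInv_inr_inl_coarse` / `KInv_inl_inr_coarse` renaming the blocks `GamΦ` / `wH`). -/
theorem e3K3_VH_unit_split_of (X Y Z : MKer (d + 1) (Fib d)) (P : Fin (d + 1) → (Fin (d + 1) → ℤ) → MKer (d + 1) (Fib d))
    (hff : ∀ κ u x z α β, P κ u x z (Sum.inl α) (Sum.inl β) = 0) (hmm : ∀ κ u x z μ ν, P κ u x z (Sum.inr μ) (Sum.inr ν) = 0)
    (cVH : ℝ) (ℓ k p : ℕ) (hp : p = ℓ + k + 1) (κ' : Fin (d + 1)) (u' x' z' : Fin (d + 1) → ℤ) (α β : Fin (d + 1)) :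
    ((Lc : ℝ) ^ p) ^ (2 * (d + 1)) *
        e3K3 X Y Z (Lc ^ p) (fun κ u => (((Lc : ℝ) ^ (d + 1)) ^ k * (cVH * ((Lc : ℝ) ^ ℓ) ^ (d + 2))) • P κ u) κ' u' x' z'
          (Sum.inl α) (Sum.inl β) =
      -(cVH / (Lc : ℝ) ^ (d + 1)) * ((Lc : ℝ) ^ p) ^ (-(2 : ℤ)) * (Lc : ℝ) ^ ℓ *
        ∑' y : Fin (d + 1) → ℤ,
          ((∑ l' : Fin (d + 1),
            (∑' w : Fin (d + 1) → ℤ, ∑ l : Fin (d + 1),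
                (((Lc : ℝ) ^ p) ^ (2 * (d + 1)) * X (((Lc ^ p : ℕ) : ℤ) • x') w (Sum.inr α) (Sum.inr l)) *
                ∑ κ'' : Fin (d + 1), (((Lc : ℝ) ^ p) ^ (d + 1))⁻¹ * ∑' u : Fin (d + 1) → ℤ,
                  (((Lc : ℝ) ^ p) ^ (d + 2) * Y u (((Lc ^ p : ℕ) : ℤ) • u') (Sum.inl κ'') (Sum.inr κ')) *
                    P κ'' u w y (Sum.inr l) (Sum.inl l')) *
              (((Lc : ℝ) ^ p) ^ (d + 2) * Z y (((Lc ^ p : ℕ) : ℤ) • z') (Sum.inl l') (Sum.inr β))) +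
          ∑ l' : Fin (d + 1),
            (∑' w : Fin (d + 1) → ℤ, ∑ l : Fin (d + 1),
                (((Lc : ℝ) ^ p) ^ (d + 2) * X (((Lc ^ p : ℕ) : ℤ) • x') w (Sum.inr α) (Sum.inl l)) *
                ∑ κ'' : Fin (d + 1), (((Lc : ℝ) ^ p) ^ (d + 1))⁻¹ * ∑' u : Fin (d + 1) → ℤ,
                  (((Lc : ℝ) ^ p) ^ (d + 2) * Y u (((Lc ^ p : ℕ) : ℤ) • u') (Sum.inl κ'') (Sum.inr κ')) *
                    P κ'' u w y (Sum.inl l) (Sum.inr l')) *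
              (((Lc : ℝ) ^ p) ^ (2 * (d + 1)) * Z y (((Lc ^ p : ℕ) : ℤ) • z') (Sum.inr l') (Sum.inr β))) := by
  subst hp
  rw [e3K3_offdiag _ _ _ _ _ (fun κ u x z α' β' => by simp only [Pi.smul_apply, smul_eq_mul, hff, mul_zero])
    (fun κ u x z μ ν => by simp only [Pi.smul_apply, smul_eq_mul, hmm, mul_zero])]
  simp only [Pi.smul_apply, smul_eq_mul]
  rw [pull_two_inner, pull_two_legs _ _ _ _ _ _ _ _ _ _ _ _ _ (by ring)]
  have h := e3VH_residual (Lc := Lc) (d := d) cVH ℓ k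
  have key : ∀ {N2 C D Z W a b c g T : ℝ}, N2 * C = D * Z * W * (a * b * c * g) →
      N2 * -(C * T) = -D * Z * W * (a * b * c * g * T) := by
    intro N2 C D Z W a b c g T h
    calc N2 * -(C * T) = -(N2 * C) * T := by ring
      _ = -(D * Z * W * (a * b * c * g)) * T := by rw [h]
      _ = -D * Z * W * (a * b * c * g * T) := by ring
  exact key h

end Split

/-! ## §4 UNITS: the three-leg functional under the diagonal rescaling of the legs -/

/-- [folklore] **THE ADOPTED UNITS RESTORE THE WEIGHT-ONE TABLE** for ANY off-diagonal family (generalising leaf-05-g19's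
`TopBorderKSlot.unitS_smul_sq_mfNeg_vhS`): `unitS s_f s_m ((s_f·s_m)² • P) = P` (nonzero units). -/
theorem unitS_smul_sq_offdiag {sf sm : ℝ} (hsf : sf ≠ 0) (hsm : sm ≠ 0) (P : Fin (d + 1) → (Fin (d + 1) → ℤ) → MKer (d + 1) (Fib d))
    (hff : ∀ κ u x z α β, P κ u x z (Sum.inl α) (Sum.inl β) = 0) (hmm : ∀ κ u x z μ ν, P κ u x z (Sum.inr μ) (Sum.inr ν) = 0) :
    unitS sf sm (fun κ u => ((sf * sm) ^ 2) • P κ u) = P := by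
  funext κ u x y a b
  rw [unitS_apply]
  rcases a with α | μ <;> rcases b with β | ν
  · simp only [Pi.smul_apply, smul_eq_mul, hff, mul_zero, zero_mul]
  · simp only [Pi.smul_apply, smul_eq_mul, legScale_inl, legScale_inr]
    field_simp
  · simp only [Pi.smul_apply, smul_eq_mul, legScale_inl, legScale_inr]
    field_simp
  · simp only [Pi.smul_apply, smul_eq_mul, hmm, mul_zero, zero_mul]

/-- [folklore] **UNITS COVARIANCE OF THE THREE-LEG FUNCTIONAL** (leaf-05-g19's `ThirdJetKernel.e3K_unit` with the legs independent):
`e3K3 (DXD) (DYD) (DZD) L (unitS S) κ′ u′ = s_m² · e3K3 X Y Z L S κ′ u′` (`D = diag(s_f ∣ s_m)`, nonzero units; `vertexOfK_unit` on the vertex leg,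
`comp_scaleK` twice, the `mm`-read keeps the two outer multiplier units). -/
theorem e3K3_unit {sf sm : ℝ} (hsf : sf ≠ 0) (hsm : sm ≠ 0) (X Y Z : MKer (d + 1) (Fib d)) (L : ℕ)
    (S : Fin (d + 1) → (Fin (d + 1) → ℤ) → MKer (d + 1) (Fib d)) (κ' : Fin (d + 1)) (u' : Fin (d + 1) → ℤ) :
    e3K3 (unitK sf sm X) (unitK sf sm Y) (unitK sf sm Z) L (unitS sf sm S) κ' u' =
      fun x z a b => sm ^ 2 * e3K3 X Y Z L S κ' u' x z a b := by
  have hV : vertexOfK (unitK sf sm Y) L (unitS sf sm S) κ' u' = counitK sf sm (vertexOfK Y L S κ' u') :=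
    vertexOfK_unit hsf hsm Y L S κ' u'
  have hc : comp (comp (unitK sf sm X) (vertexOfK (unitK sf sm Y) L (unitS sf sm S) κ' u')) (unitK sf sm Z) =
      scaleK (legScale sf sm) (legScale sf sm) (comp (comp X (vertexOfK Y L S κ' u')) Z) := by
    rw [hV]
    simp only [unitK, counitK]
    rw [comp_scaleK _ _ _ _ (legScale_mul_legScale_inv hsf hsm), comp_scaleK _ _ _ _ (legScale_inv_mul_legScale hsf hsm)]
  funext x z a b
  rcases a with α | μ
  · rcases b with β | ν
    · simp only [e3K3, mmRead_inl_inl]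
      rw [hc, HessKerRate.scaleK_apply, legScale_inr, legScale_inr]
      ring
    · simp only [e3K3_inr_right, mul_zero]
  · simp only [e3K3_inr_left, mul_zero]

/-- [folklore] **`e3K3_unitK_offdiag` — THE THREE-LEG FUNCTIONAL OF AN OFF-DIAGONAL TABLE UNDER THE LEG UNITS**:
`e3K3 (DXD) (DYD) (DZD) L P = s_m²·(s_f s_m)² · e3K3 X Y Z L P` — every channel carries one `mm` outer leg (`s_m²`), one mixed outer leg
(`s_f s_m`) and the `ℋ`-column (`s_f s_m`).  (Row dV: `s_f = Lc`, `s_m = Lc^{d+1}` turns the `Lc`-decimated level-`(n+3)` resolvent in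
`Lc^{n+3}`-units into a kernel read in `Lc^{n+2}`-units, factor `Lc^{4d+6}`.) -/
theorem e3K3_unitK_offdiag {sf sm : ℝ} (hsf : sf ≠ 0) (hsm : sm ≠ 0) (X Y Z : MKer (d + 1) (Fib d)) (L : ℕ)
    (P : Fin (d + 1) → (Fin (d + 1) → ℤ) → MKer (d + 1) (Fib d))
    (hff : ∀ κ u x z α β, P κ u x z (Sum.inl α) (Sum.inl β) = 0) (hmm : ∀ κ u x z μ ν, P κ u x z (Sum.inr μ) (Sum.inr ν) = 0)
    (κ' : Fin (d + 1)) (u' : Fin (d + 1) → ℤ) (x z : Fin (d + 1) → ℤ) (a b : Fib d) :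
    e3K3 (unitK sf sm X) (unitK sf sm Y) (unitK sf sm Z) L P κ' u' x z a b =
      sm ^ 2 * (sf * sm) ^ 2 * e3K3 X Y Z L P κ' u' x z a b := by
  have h := e3K3_unit hsf hsm X Y Z L (fun κ u => ((sf * sm) ^ 2) • P κ u) κ' u'
  rw [unitS_smul_sq_offdiag hsf hsm P hff hmm, e3K3_smul] at h
  rw [h]
  simp only [Pi.smul_apply, smul_eq_mul]
  ring

end Summit.QuantumFields.BalabanUV.Beta.GAN24.ThirdJetThreeKernel

end
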